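import Literature.AnabelianGeometry.EtaleTheta.ThetaCoversAxioms
import Literature.NumberTheory.GaloisRepresentations.DihedralGroupRecognition
import Mathlib.GroupTheory.Index

/-!
# [EtTh] Remark 2.6.1, the `X̲`-clause on the profinite side: `N_{Π_C}(Π_{X̲}) = Π_C` and
# `Π_C/Π_{X̲} ≅ ℤ/lℤ ⋊ {±1}` (dihedral), PROVED over `CoverDataAx` (proof-only companion)

Mochizuki, *The Étale Theta Function …* [EtTh], Publ. RIMS 45 (2009), §2, Remark 2.6.1, PRIMS text
p.40 (printed p.266; locators `p.N` = PDF pages; bib key `MochizukiEtTh2009`): "`Aut_K(X̲^log) =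
ℤ/lℤ ⋊ {±1}` … where the semi-direct product is with respect to the natural multiplicative action of
`±1` on `ℤ/lℤ`" [cite: MochizukiEtTh2009, Rmk 2.6.1 p.40].

Cell abc-iut, layer L2, discharge seat abc-iut-L2-d3 (node EtTh:Rmk2.6.1; companion of seat
abc-iut-L2-t2's `ThetaCoversTempered.lean`, named fact `TemperedCoverData.Rmk261`, whose `X̲`-clause reads
`Nonempty (T.autK (T.tp T.PiXu) ≃* DihedralGroup l)`). This file is the PROFINITE half, pure group
theory over the interface `ThetaCovers.CoverDataAx` (`ThetaCovers.lean`, `ThetaCoversAxioms.lean`):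

* `nonempty_quotient_mulEquiv_dihedralGroup` — recognition: `N ⊴ G` inside an index-`2` subgroup
  `P` with `P/N ≅ ℤ/nℤ` (a surjection `φ : P ↠ ℤ/nℤ` with kernel `N`), and `s ∉ P` with `s² ∈ N`
  inverting `P/N`, give `G/N ≅ D_n` (via the tree's `nonempty_mulEquiv_dihedralGroup`);
* `inf_PiX_normal` — for `Π_{C̲} = H'` of type `(1, l-tors)±` with an inversion `ι̲`, the subgroup
  `Π_{X̲} = H' ∩ Π_X` is NORMAL in `Π_C` (it is the kernel of `Π_X ↠ Q` and is normalised by `ι̲ ∈ Π_{C̲}`),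
  i.e. `N_{Π_C}(Π_{X̲}) = Π_C` (`normalizer_inf_PiX_eq_top`);
* `inversion_conj_mul_mem` — the inversion acts by `−1` on `Π_X/Π_{X̲} ≅ Q` ("`ι` acts on `Q` by
  multiplication by `−1`", Rmk 2.1.1 p.36; from `CoverDataAx.inv_ell` and `Π_X = Π_{X̲} · Δ_X`);
* `nonempty_quotient_inf_PiX_mulEquiv_dihedralGroup` — **`Π_C/Π_{X̲} ≅ D_l = ℤ/lℤ ⋊ {±1}`**,
  unconditionally (`l` odd is a field of the interface; `ι̲² ∈ Ker(Δ_X ↠ Δ̄_X)`, Prop 2.2 (iii)).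

The transfer to the tempered group `Π^tp_C` (the typed `autK (tp PiXu)`) is in the sibling file
`Sec2AutKTempered.lean`. No new definition, no named fact; nothing here asserts that a `CoverDataAx`
exists; no side is taken on any disputed claim.
-/

namespace Literature.AnabelianGeometry.EtaleTheta

namespace ThetaCovers

open Literature.NumberTheory.GaloisRepresentations (nonempty_mulEquiv_dihedralGroup)

universe u

/-! ### Dihedral recognition for a quotient -/

/-- **Dihedral quotients.** Let `N ⊴ G`, `N ≤ P ≤ G` with `[G : P] = 2`, `φ : P ↠ ℤ/nℤ`
(`n ≠ 0`) with kernel `N`, and `s ∈ G ∖ P` with `s² ∈ N` and `s x s⁻¹ x ∈ N` for all `x ∈ P`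
(the inversion acts by `−1` on `P/N`). Then `G/N ≅ D_n`. This is the group theory of [EtTh]
Rmk 2.6.1 "`Aut_K(X̲^log) = ℤ/lℤ ⋊ {±1}`". [cite: MochizukiEtTh2009, Rmk 2.6.1 p.40] -/
theorem nonempty_quotient_mulEquiv_dihedralGroup {G : Type*} [Group G] {n : ℕ} [NeZero n]
    (N P : Subgroup G) [N.Normal] (hNP : N ≤ P) (hP : P.index = 2)
    (φ : P →* Multiplicative (ZMod n)) (hφs : Function.Surjective φ)
    (hφk : ∀ x : P, φ x = 1 ↔ (x : G) ∈ N) {s : G} (hs : s ∉ P) (hs2 : s * s ∈ N)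
    (hinv : ∀ x ∈ P, s * x * s⁻¹ * x ∈ N) :
    Nonempty (G ⧸ N ≃* DihedralGroup n) := by
  have hn : 0 < n := Nat.pos_of_ne_zero (NeZero.ne n)
  -- `[G : N] = 2n`, so the quotient is finite
  have hker : φ.ker = N.subgroupOf P := by
    ext x
    rw [MonoidHom.mem_ker, Subgroup.mem_subgroupOf]
    exact hφk x
  have hrel : N.relIndex P = n := by
    change (N.subgroupOf P).index = n
    rw [← hker, Subgroup.index_ker, MonoidHom.range_eq_top.mpr hφs, Subgroup.card_top,
      Nat.card_eq_fintype_card, Fintype.card_multiplicative, ZMod.card]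
  have hidx : N.index = n * 2 := by
    rw [← Subgroup.relIndex_mul_index hNP, hrel, hP]
  haveI : N.FiniteIndex := ⟨by rw [hidx]; positivity⟩
  haveI : Finite (G ⧸ N) := Subgroup.finite_quotient_of_finiteIndex
  -- a generator `a` of `P/N`
  obtain ⟨a, ha⟩ := hφs (Multiplicative.ofAdd 1)
  set aq : G ⧸ N := QuotientGroup.mk (a : G) with haq
  set sq : G ⧸ N := QuotientGroup.mk s with hsq
  -- powers of `a` represent all of `P` modulo `N`
  have hφpow : ∀ m : ℕ, φ (a ^ m) = Multiplicative.ofAdd (m : ZMod n) := by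
    intro m
    rw [map_pow, ha, ← ofAdd_nsmul, nsmul_one]
  have hpow_mem : ∀ m : ℕ, ((a : G) ^ m ∈ N ↔ n ∣ m) := by
    intro m
    rw [← Subgroup.coe_pow, ← hφk, hφpow, ← ofAdd_zero, Multiplicative.ofAdd.injective.eq_iff,
      ZMod.natCast_eq_zero_iff]
  have haqpow : ∀ m : ℕ, aq ^ m = 1 ↔ n ∣ m := by
    intro m
    rw [haq, ← QuotientGroup.mk_pow, QuotientGroup.eq_one_iff, hpow_mem]
  have hord : orderOf aq = n := by
    rw [orderOf_eq_iff hn]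
    refine ⟨(haqpow n).mpr dvd_rfl, fun m hm hm0 h => ?_⟩
    exact absurd (Nat.le_of_dvd hm0 ((haqpow m).mp h)) (not_le.mpr hm)
  have hPpow : ∀ x ∈ P, (QuotientGroup.mk x : G ⧸ N) ∈ Subgroup.zpowers aq := by
    intro x hx
    set m := (Multiplicative.toAdd (φ ⟨x, hx⟩)).val with hm
    have hφx : φ ⟨x, hx⟩ = φ (a ^ m) := by
      rw [hφpow, hm, ZMod.natCast_zmod_val, ofAdd_toAdd]
    have hxN : ((a ^ m)⁻¹ * ⟨x, hx⟩ : P) ∈ φ.ker := by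
      rw [MonoidHom.mem_ker, map_mul, map_inv, hφx, inv_mul_cancel]
    rw [hker, Subgroup.mem_subgroupOf] at hxN
    have : (QuotientGroup.mk x : G ⧸ N) = aq ^ m := by
      rw [haq, ← QuotientGroup.mk_pow, eq_comm, QuotientGroup.eq]
      simpa using hxN
    rw [this]
    exact Subgroup.pow_mem _ (Subgroup.mem_zpowers aq) m
  -- the hypotheses of the recognition theorem
  have h1 : sq ∉ Subgroup.zpowers aq := by
    intro h
    obtain ⟨k, hk⟩ := Subgroup.mem_zpowers_iff.mp h
    rw [haq, hsq, ← QuotientGroup.mk_zpow, QuotientGroup.eq] at hk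
    have hak : ((a : G) ^ k)⁻¹ ∈ P := Subgroup.inv_mem _ (Subgroup.zpow_mem _ a.2 k)
    exact hs ((Subgroup.mul_mem_cancel_left P hak).mp (hNP hk))
  have h2 : sq * sq = 1 := by
    rw [hsq, ← QuotientGroup.mk_mul, QuotientGroup.eq_one_iff]
    exact hs2
  have h3 : sq * aq * sq⁻¹ = aq⁻¹ := by
    rw [eq_inv_iff_mul_eq_one, hsq, haq, ← QuotientGroup.mk_mul, ← QuotientGroup.mk_inv,
      ← QuotientGroup.mk_mul, ← QuotientGroup.mk_mul, QuotientGroup.eq_one_iff]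
    exact hinv a a.2
  have h4 : ∀ g : G ⧸ N, g ∈ Subgroup.zpowers aq ∨ sq⁻¹ * g ∈ Subgroup.zpowers aq := by
    intro g
    induction g using QuotientGroup.induction_on with
    | H x =>
      by_cases hx : x ∈ P
      · exact Or.inl (hPpow x hx)
      · right
        have hsx : s⁻¹ * x ∈ P :=
          (Subgroup.mul_mem_iff_of_index_two hP).mpr
            (iff_of_false (fun h => hs ((Subgroup.inv_mem_iff P).mp h)) hx)
        rw [hsq, ← QuotientGroup.mk_inv, ← QuotientGroup.mk_mul]
        exact hPpow _ hsx
  obtain ⟨e⟩ := nonempty_mulEquiv_dihedralGroup h1 h2 h3 h4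
  rw [hord] at e
  exact ⟨e⟩

namespace CoverDataAx

variable {l : ℕ} (X : CoverDataAx.{u} l)

/-! ### `Π_{X̲}` is normal in `Π_C` -/

/-- For `Π_{C̲} = H'` of type `(1, l-tors)±` and `ι̲ ∈ Π_{C̲}` an inversion, `ι̲` normalises
`Π_{X̲} = Π_{C̲} ∩ Π_X` (both `Π_{C̲}` and the normal subgroup `Π_X` are stable).
[cite: MochizukiEtTh2009, Def 2.1 p.36] -/
theorem inversion_conj_mem_inf {H' : Subgroup X.PiC} {ι : X.PiC} (hι : X.toCoverData.IsInversion H' ι)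
    {x : X.PiC} (hx : x ∈ H' ⊓ X.PiX) : ι * x * ι⁻¹ ∈ H' ⊓ X.PiX :=
  haveI := X.PiX_normal
  ⟨Subgroup.mul_mem _ (Subgroup.mul_mem _ hι.mem hx.1) (Subgroup.inv_mem _ hι.mem),
    X.PiX_normal.conj_mem _ hx.2 ι⟩

/-- `Π_{X̲} = Ker(Π_X ↠ Q)` is normalised by `Π_X`. [cite: MochizukiEtTh2009, Def 2.1 p.36] -/
theorem conj_mem_of_isTypeLTors {H : Subgroup X.PiC} (hT : X.toCoverData.IsTypeLTors H)
    {g : X.PiC} (hg : g ∈ X.PiX) {x : X.PiC} (hx : x ∈ H) : g * x * g⁻¹ ∈ H := by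
  obtain ⟨φ, -, hφk⟩ := hT.quot
  have hxX : x ∈ X.PiX := hT.le hx
  have h1 : φ ⟨x, hxX⟩ = 1 := (hφk _).mpr hx
  have : φ (⟨g, hg⟩ * ⟨x, hxX⟩ * ⟨g, hg⟩⁻¹) = 1 := by
    rw [map_mul, map_mul, map_inv, h1, mul_one, mul_inv_cancel]
  exact (hφk _).mp this

/-- **`Π_{X̲}` is normal in `Π_C`** (`N_{Π_C}(Π_{X̲}) = Π_C`): `Π_C = Π_X ∪ ι̲·Π_X` and both `Π_X` and
`ι̲` normalise `Π_{X̲}` — the `X̲`-clause of Rmk 2.6.1 says `Aut_K(X̲) = N(Π_{X̲})/Π_{X̲}` has order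
`2l = [Π_C : Π_{X̲}]`. [cite: MochizukiEtTh2009, Rmk 2.6.1 p.40] -/
theorem inf_PiX_normal {H' : Subgroup X.PiC} {ι : X.PiC} (hH' : X.toCoverData.IsTypeLTorsPm H')
    (hι : X.toCoverData.IsInversion H' ι) : (H' ⊓ X.PiX).Normal := by
  have hT := hH'.inf_isTypeLTors
  refine ⟨fun x hx g => ?_⟩
  by_cases hg : g ∈ X.PiX
  · exact X.conj_mem_of_isTypeLTors hT hg hx
  · -- `g = ι (ι⁻¹ g)` with `ι⁻¹ g ∈ Π_X`
    have hιg : ι⁻¹ * g ∈ X.PiX :=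
      (Subgroup.mul_mem_iff_of_index_two X.index_PiX).mpr
        (iff_of_false (fun h => hι.not_mem ((Subgroup.inv_mem_iff X.PiX).mp h)) hg)
    have h1 := X.conj_mem_of_isTypeLTors hT hιg hx
    have h2 := X.inversion_conj_mem_inf hι h1
    have : ι * (ι⁻¹ * g * x * (ι⁻¹ * g)⁻¹) * ι⁻¹ = g * x * g⁻¹ := by group
    rwa [this] at h2

/-- `N_{Π_C}(Π_{X̲}) = Π_C`. [cite: MochizukiEtTh2009, Rmk 2.6.1 p.40] -/
theorem normalizer_inf_PiX_eq_top {H' : Subgroup X.PiC} {ι : X.PiC}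
    (hH' : X.toCoverData.IsTypeLTorsPm H') (hι : X.toCoverData.IsInversion H' ι) :
    Subgroup.normalizer ((H' ⊓ X.PiX : Subgroup X.PiC) : Set X.PiC) = ⊤ :=
  haveI := X.inf_PiX_normal hH' hι
  Subgroup.normalizer_eq_top (H := H' ⊓ X.PiX)

/-- `[Π_C : Π_{X̲}] = 2l`. [cite: MochizukiEtTh2009, Rmk 2.3.1 p.38] -/
theorem index_inf_PiX {H' : Subgroup X.PiC} (hH' : X.toCoverData.IsTypeLTorsPm H') :
    (H' ⊓ X.PiX).index = l * 2 := by
  rw [← Subgroup.relIndex_mul_index (inf_le_right : H' ⊓ X.PiX ≤ X.PiX),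
    X.index_typeLTors _ hH'.inf_isTypeLTors, X.index_PiX]

/-! ### The inversion acts by `−1` on `Π_X/Π_{X̲}` -/

/-- **"`ι` acts on `Q` by multiplication by `−1`"** (Rmk 2.1.1, p.36): for `x ∈ Π_X`,
`ι̲ x ι̲⁻¹ x ∈ Π_{X̲}` — write `x = h d` with `h ∈ Π_{X̲}`, `d ∈ Δ_X` (`Π_X = Π_{X̲} · Δ_X`) and use that the
inversion acts by `−1` on `Δ̄^ell_X` (`CoverDataAx.inv_ell`: `ι̲ d ι̲⁻¹ d ∈ Δ̄_Θ`-preimage `⊆ Π_{X̲}`).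
[cite: MochizukiEtTh2009, Rmk 2.1.1 p.36] -/
theorem inversion_conj_mul_mem {H' : Subgroup X.PiC} {ι : X.PiC}
    (hH' : X.toCoverData.IsTypeLTorsPm H') (hι : X.toCoverData.IsInversion H' ι)
    {x : X.PiC} (hx : x ∈ X.PiX) : ι * x * ι⁻¹ * x ∈ H' ⊓ X.PiX := by
  haveI := X.PiX_normal
  haveI : X.DeltaX.Normal := inferInstance
  have hT := hH'.inf_isTypeLTors
  have hx' : x ∈ (H' ⊓ X.PiX) ⊔ X.DeltaX := by rw [hT.delta_sup]; exact hx
  obtain ⟨h, hh, d, hd, rfl⟩ := Subgroup.mem_sup_of_normal_right.mp hx'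
  have hdd : ι * d * ι⁻¹ * d ∈ H' ⊓ X.PiX :=
    hT.barTheta_le (X.inv_ell ι hι.mem_delta hι.not_mem d hd)
  have hιh : ι * h * ι⁻¹ ∈ H' ⊓ X.PiX := X.inversion_conj_mem_inf hι hh
  have hdhd : d⁻¹ * h * d ∈ H' ⊓ X.PiX := by
    have := X.conj_mem_of_isTypeLTors hT (Subgroup.inv_mem _ hd.1) hh
    simpa using this
  have : ι * (h * d) * ι⁻¹ * (h * d) = (ι * h * ι⁻¹) * (ι * d * ι⁻¹ * d) * (d⁻¹ * h * d) := by group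
  rw [this]
  exact Subgroup.mul_mem _ (Subgroup.mul_mem _ hιh hdd) hdhd

/-! ### `Π_C/Π_{X̲} ≅ D_l` -/

/-- **Remark 2.6.1, `X̲`-clause, profinite form: `Π_C/Π_{X̲} ≅ ℤ/lℤ ⋊ {±1} = D_l`** — for
`Π_{C̲} = H'` of type `(1, l-tors)±` and an inversion `ι̲ ∈ Π_{C̲}` of order `2` in `Δ̄_{C̲}` (`ι̲² ∈ Ker`,
Prop 2.2 (iii)): the quotient of `Π_C` by the normal subgroup `Π_{X̲} = H' ∩ Π_X` is dihedral of order
`2l`, generated by `Π_X/Π_{X̲} ≅ ℤ/lℤ` and the involution `ι̲` acting by `−1`. PROVED over `CoverDataAx`.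
[cite: MochizukiEtTh2009, Rmk 2.6.1 p.40] -/
theorem nonempty_quotient_inf_PiX_mulEquiv_dihedralGroup {H' : Subgroup X.PiC} {ι : X.PiC}
    (hH' : X.toCoverData.IsTypeLTorsPm H') (hι : X.toCoverData.IsInversion H' ι)
    (h2 : ι * ι ∈ X.barKer) :
    haveI := X.inf_PiX_normal hH' hι
    Nonempty (X.PiC ⧸ (H' ⊓ X.PiX) ≃* DihedralGroup l) := by
  haveI := X.inf_PiX_normal hH' hι
  haveI : NeZero l := ⟨by obtain ⟨k, hk⟩ := X.l_odd; omega⟩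
  have hT := hH'.inf_isTypeLTors
  obtain ⟨φ, hφs, hφk⟩ := hT.quot
  refine nonempty_quotient_mulEquiv_dihedralGroup (H' ⊓ X.PiX) X.PiX inf_le_right X.index_PiX
    φ hφs hφk hι.not_mem ?_ fun x hx => X.inversion_conj_mul_mem hH' hι hx
  exact hT.barTheta_le (X.barKer_le_barTheta h2)

end CoverDataAx

end ThetaCovers

end Literature.AnabelianGeometry.EtaleTheta
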